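import Summits.BirchSwinnertonDyer.Rank1Residual.X5.TwoAdicInstancesToolkit
import HarnessLib

/-!
# X5 at `p = 2` (cell `bsd-2adic`, seat `bsd-2adic-ord`): toolkit, part C — the Greenberg type of the
# UNIQUE rational point of order `2` on a curve whose other two `2`-torsion abscissae are irrational

For the (34-GV) class-closure files (targets and `λ`-references are curves with exactly ONE rational
point of order `2`): writing the `2`-division cubic as `(x − x₀)(4x² + ux + v)` with `x₀ ∈ ℚ` and
discriminant `u² − 16v` of the quadratic cofactor, elementary real-algebra bookkeeping decides
"`x₀` is the least real root" (Greenberg's "odd", via `le_of_cubic_factor_of_lt` /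
`le_of_cubic_factor_of_neg`), "there is a smaller real root" (NOT odd, `exists_cubic_root_lt`), and the
uniqueness of the rational root (`eq_of_cubic_factor_of_not_isSquare`: `4z² + uz + v = 0` with `z ∈ ℚ`
would make `u² − 16v = (8z + u)²` a rational square). HONEST FRAMING as in `X5/TwoAdicInstancesToolkit.lean`;
nothing asserted, 0 named facts. [GreenbergLNM1716] §5 (the predicates); folklore algebra.
-/

set_option autoImplicit false

namespace Summit.BirchSwinnertonDyer.Rank1Residual.X5.Instances

/-- **`x₀` is the least real root** of `(x − x₀)(4x² + ux + v)` when the quadratic's roots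
`(−u ± √(u² − 16v))/8` lie to the right of `x₀`: `0 < −u − 8x₀` and `u² − 16v < (−u − 8x₀)²`.
[folklore] -/
theorem le_of_cubic_factor_of_lt {x₀ u v : ℝ} (r : ℝ) (h : (r - x₀) * (4 * r ^ 2 + u * r + v) = 0)
    (hpos : 0 < -u - 8 * x₀) (hlt : u ^ 2 - 16 * v < (-u - 8 * x₀) ^ 2) : x₀ ≤ r := by
  rcases mul_eq_zero.mp h with h1 | h2
  · linarith
  · by_contra hlt'
    push Not at hlt'
    have hsq : (8 * r + u) ^ 2 = u ^ 2 - 16 * v := by linear_combination 16 * h2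
    have hneg : -(8 * r + u) > -u - 8 * x₀ := by linarith
    nlinarith [hneg, hpos, hsq]

/-- **`x₀` is the only real root** of `(x − x₀)(4x² + ux + v)` when `u² − 16v < 0` (no real root of
the quadratic cofactor); in particular it is the least one. [folklore] -/
theorem le_of_cubic_factor_of_neg {x₀ u v : ℝ} (r : ℝ) (h : (r - x₀) * (4 * r ^ 2 + u * r + v) = 0)
    (hneg : u ^ 2 - 16 * v < 0) : x₀ ≤ r := by
  rcases mul_eq_zero.mp h with h1 | h2
  · linarith
  · have hsq : (8 * r + u) ^ 2 = u ^ 2 - 16 * v := by linear_combination 16 * h2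
    nlinarith [sq_nonneg (8 * r + u)]

/-- **A real root to the LEFT of `x₀`**: if `0 ≤ u² − 16v` and `−u − 8x₀ < √(u² − 16v)`, then
`r = (−u − √(u² − 16v))/8 < x₀` is a root of `(x − x₀)(4x² + ux + v)` (so the point with abscissa `x₀`
is NOT "odd"). [folklore] -/
theorem exists_cubic_root_lt {x₀ u v : ℝ} (hD : 0 ≤ u ^ 2 - 16 * v)
    (h : -u - 8 * x₀ < Real.sqrt (u ^ 2 - 16 * v)) :
    ∃ r : ℝ, (r - x₀) * (4 * r ^ 2 + u * r + v) = 0 ∧ r < x₀ := by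
  set s := Real.sqrt (u ^ 2 - 16 * v) with hs_def
  have hs : s ^ 2 = u ^ 2 - 16 * v := Real.sq_sqrt hD
  refine ⟨(-u - s) / 8, ?_, by linarith⟩
  have hq : 4 * ((-u - s) / 8) ^ 2 + u * ((-u - s) / 8) + v = 0 := by nlinarith [hs]
  rw [hq, mul_zero]

/-- **Uniqueness of the rational root**: if `(z − x₀)(4z² + uz + v) = 0` with `z, x₀, u, v ∈ ℚ` and
`u² − 16v` is not the square of a rational, then `z = x₀` (else `u² − 16v = (8z + u)²`). [folklore] -/
theorem eq_of_cubic_factor_of_not_isSquare {x₀ u v : ℚ} (z : ℚ)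
    (h : (z - x₀) * (4 * z ^ 2 + u * z + v) = 0) (hD : ¬ IsSquare (u ^ 2 - 16 * v)) : z = x₀ := by
  rcases mul_eq_zero.mp h with h1 | h2
  · linarith
  · exfalso
    exact hD ⟨8 * z + u, by linear_combination (-16) * h2⟩

end Summit.BirchSwinnertonDyer.Rank1Residual.X5.Instances
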